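import Literature.Analysis.FluidPDE.KNSSThm53Discharge
import Literature.Analysis.FluidPDE.KNSSSwirlFromVorticity
import Literature.Analysis.FluidPDE.KNSSRegularityAncient
import Literature.Analysis.FluidPDE.KNSSThm52GoodTimes
import Literature.Analysis.FluidPDE.KNSSProp41OfLocal
import Literature.Analysis.FluidPDE.KNSSThm52OfProp41
import Literature.Analysis.FluidPDE.KNSSLiouvillePlanarHolds
import HarnessLib

/-!
# KNSS 2009, Theorem 5.3 from §4 on finite windows: the axisymmetric representative

Analysis/FluidPDE proofs file (everything proved; no definitions, no named facts) on the discharge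
path of the named fact `Literature.Analysis.FluidPDE.KNSS2009_liouville_bound_C_over_r`
(`KNSSLiouville`; Koch–Nadirashvili–Seregin–Šverák, *Liouville theorems for the Navier–Stokes
equations and applications*, Acta Math. 203 (2009) = arXiv:0709.3599, **Theorem 5.3**: an
axisymmetric bounded weak solution in `ℝ³ × (−∞, 0)` with `|u| ≤ C/r` vanishes).

After `KNSSThm53Discharge` (Lemma 2.1 and the cut-off argument (5.12)–(5.20) proved) the target
rests on two §4 inputs, `KNSS2009_regularity_axisymmetric_swirl` (§4 (4.6)–(4.8) for an
*axisymmetric* representative `U` with *axial* parasitic part `β(t) e_z`, with the swirl equation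
(5.10) in time-integrated form) and `KNSS2009_regularity_boundedWeak_window` (§4 as printed, on
`ℝ³ × (0, T)`). This file proves the former from the latter,

* `KNSS2009_regularity_axisymmetric_swirl_of_window :
    KNSS2009_regularity_boundedWeak_window → KNSS2009_regularity_axisymmetric_swirl`,

so that Theorem 5.3 — in the printed form and in the tree's duality form `knss_bound_C_over_r` —
rests on the single printed statement of §4 on finite windows, and through the tree's reductions
of that statement (`KNSSRegularityWindowOfProp41`, `KNSSProp41OfLocal`) on Proposition 4.1 in its
local form `knss2009_local_smoothing ℝ³` alone:

* `KNSS2009_liouville_bound_C_over_r_of_window`, `KNSS2009_liouville_bound_C_over_r_of_prop41_mild`,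
  `KNSS2009_liouville_bound_C_over_r_of_local`; `knss_bound_C_over_r_of_window`,
  `knss_bound_C_over_r_of_local`.

**Discharges (appended 2026-08-15, once `KNSS2009_mild_regularity_holds` of
`KNSSLiouvillePlanarHolds` had landed).** The §4 regularity of bounded mild solutions being a
theorem, so is §4 on finite windows (`KNSS2009_regularity_boundedWeak_window_holds`, through
`KNSS2009_regularity_boundedWeak_window_of_mild_regularity`), and with it everything above:
`KNSS2009_regularity_axisymmetric_swirl_holds`, **Theorem 5.2**
`KNSS2009_liouville_axisymmetric_no_swirl_holds` (duality forms `knss2009_axisymmetric_no_swirl_holds`,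
`knss2009_axisymmetric_no_swirl'_holds`), **Theorem 5.3** `KNSS2009_liouville_bound_C_over_r_holds`
(duality form `knss_bound_C_over_r_holds`, ns.S22). Every ingredient of the printed proofs of
§§2–5 used by Theorems 5.1–5.3 is now a theorem of the tree; no named fact remains below them.

## The argument (KNSS p. 10, first lines of the proof of Theorem 5.3, with §4 and Remark 3.1)

Let `u` be a bounded weak solution on `ℝ³ × (−∞, 0)`, axisymmetric as an `L^∞` function. As in
`KNSSRegularityAncient`, apply the window fact (time-translated, `T = 4`, `δ = 1`) on the windows
`W_j = (−j − 4, −j)` and glue the decompositions `u = U_j + b_j` along `ι(t) = ⌈−t⌉₊ − 1`; write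
`U_g(t) = U_{ι(t)}(t)`, `b_g(t) = b_{ι(t)}(t)` (smooth divergence-free slices, uniform bounds,
derivatives of order `≥ 1` Lipschitz in time, the vorticity equation (4.5), `glue_vorticity`).
Two defects remain: `U_g` itself need not be Lipschitz in time across pieces (on overlaps the
windowed fields differ by `x`-independent constants, Remark 3.1: "`w` and `b` are determined up to
a constant"), and `U_g(t, ·)` is axisymmetric only up to the constant `b_g(t)`. Both are removed
by the **normalisation at the axis**
`V(t, x) = U_g(t, x) − U_g(t, 0)`, `b̂(t) = b_g(t) + U_g(t, 0)`, `u = V + b̂`: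

* `V` is canonical: on the common good range of two windows `U_j(t, ·) − U_j(t, 0)` does not
  depend on `j` (`overlap_sub_eq`), so `V` inherits the order-`0` Lipschitz bound of the windows
  (`norm_sub_normalised_glue_le`); derivatives of order `≥ 1`, the divergence and the vorticity do
  not see the constant;
* at a.e. `t < 0` ("good times": countably many rational angles and continuity in `x`,
  `isAxisymmetric_of_ae_rat`) the continuous field `U_g(t, ·) + b_g(t)` is pointwise
  axisymmetric; evaluating at the fixed point `0` of the rotations shows that `b̂(t)` is
  rotation invariant, i.e. **axial**, `b̂(t) = β(t) e_z`, and that `V(t, ·)` is axisymmetric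
  (`isAxisymmetric_normalised`, `eq_smul_eZ_of_rotZ_pi_eq`);
* `V(t, ·)` is then axisymmetric at **every** `t < 0` by continuity in time
  (`forall_eq_zero_of_ae_restrict_Iio`);
* the vorticity identity of `U_g` with drift `U_g + b_g = V + b̂` is that of `V` with drift
  `V + β e_z` (the drifts agree for a.e. `τ`, `intervalIntegral.integral_congr_ae`), and the
  swirl equation (5.10) follows from it by `swirl_identity_of_vorticity_identity`
  (`KNSSSwirlFromVorticity`: a curl-free axisymmetric `C¹` field has no swirl).

## Mathlib / tree search

Tree (all reused): `KNSS2009_regularity_boundedWeak_window.shift`, `glue_vorticity`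
(`KNSSRegularityAncient`); `measurable_glue`, `measurable_uncurry_glue`, `ae_eq_glue`,
`overlap_sub_eq`, `overlap_iteratedFDeriv_succ_eq`, `glue_pointwise`, `glue_lipschitz`,
`continuousOn_of_norm_sub_le_mul`, `norm_sub_eq_norm_iteratedFDeriv_zero_sub`
(`KNSSRegularityGluing`); `isAxisymmetric_of_ae_rat`, `forall_eq_zero_of_ae_restrict_Iio`
(`KNSSThm52GoodTimes`); `measurePreserving_rotZ`, `eq_smul_eZ_of_rotZ_pi_eq`
(`KNSSAxisymmetricNoSwirl`); `rotZL`
(`AxisymmetricVorticityTransport`); `swirl_identity_of_vorticity_identity`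
(`KNSSSwirlFromVorticity`); `KNSS2009_liouville_bound_C_over_r_of_regularity_of_window`,
`knss_bound_C_over_r_of_KNSS2009` (`KNSSThm53Discharge`, `AncientMildRepresentative`);
`KNSS2009_regularity_boundedWeak_window_of_prop41_mild`, `KNSS2009_prop41_mild_of_local`.
`lean search 'regularity_axisymmetric_swirl_of|iteratedFDeriv_sub_const'`: nothing prior (the
assembly announced in the docstring of `KNSSSwirlFromVorticity` is not in the tree).

## References

* G. Koch, N. Nadirashvili, G. Seregin, V. Šverák, *Liouville theorems for the Navier–Stokes
  equations and applications*, Acta Math. 203 (2009) 83–105 = arXiv:0709.3599 (arXiv page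
  numbers): §3 Remark 3.1 (p. 7); §4 (4.5)–(4.8) (p. 8); §5 (5.10) and the proof of Theorem 5.3,
  first lines (p. 10); Theorem 5.2 (pp. 9–10). [KochNadirashviliSereginSverak2009]
-/

noncomputable section

open MeasureTheory Set Function Filter TopologicalSpace InnerProductSpace
open _root_.Topology
open scoped RealInnerProductSpace Laplacian ContDiff NNReal

namespace Literature.Analysis.FluidPDE

/-! ### Pointwise algebra of the normalisation at the axis -/

section Pointwise

/-- Subtracting a constant does not change the derivatives of order `≥ 1`. [folklore] -/
theorem iteratedFDeriv_succ_sub_const {E' F : Type*} [NormedAddCommGroup E'] [NormedSpace ℝ E']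
    [NormedAddCommGroup F] [NormedSpace ℝ F] (f : E' → F) (c : F) (n : ℕ) (x : E') :
    iteratedFDeriv ℝ (n + 1) (fun y => f y - c) x = iteratedFDeriv ℝ (n + 1) f x := by
  rw [iteratedFDeriv_succ_eq_comp_right, iteratedFDeriv_succ_eq_comp_right]
  have hF : fderiv ℝ (fun y => f y - c) = fderiv ℝ f := funext fun y => fderiv_sub_const c
  simp only [Function.comp_apply, hF]

/-- The rotations about the axis fix the origin. [folklore] -/
theorem rotZ_apply_zero_vec (θ : ℝ) : rotZ θ (0 : EuclideanSpace ℝ (Fin 3)) = 0 := by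
  rw [← rotZL_apply, map_zero]

/-- **Normalisation at the axis.** If the continuous-in-`x` representative `V + b` (`b` a
constant vector) is axisymmetric, then `V − V(0)` is axisymmetric and the constant `b + V(0)` is
invariant under all rotations about the axis (evaluate the equivariance at the fixed point `0`
and subtract). This is the choice of representative behind "the parasitic part of an
axisymmetric solution can be taken axial" in `KNSS2009_regularity_axisymmetric_swirl`. [folklore] -/
theorem isAxisymmetric_normalised {V : EuclideanSpace ℝ (Fin 3) → EuclideanSpace ℝ (Fin 3)}
    {b : EuclideanSpace ℝ (Fin 3)} (h : IsAxisymmetric fun x => V x + b) :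
    IsAxisymmetric (fun x => V x - V 0) ∧ ∀ θ : ℝ, rotZ θ (b + V 0) = b + V 0 := by
  have h0 : ∀ θ : ℝ, V 0 + b = rotZ θ (V 0 + b) := fun θ => by
    have := h θ 0
    rwa [rotZ_apply_zero_vec] at this
  refine ⟨fun θ x => ?_, fun θ => by rw [add_comm]; exact (h0 θ).symm⟩
  have hx : V (rotZ θ x) + b = rotZ θ (V x + b) := h θ x
  have e1 : V (rotZ θ x) - V 0 = (V (rotZ θ x) + b) - (V 0 + b) := by abel
  have e2 : rotZ θ (V x + b) - rotZ θ (V 0 + b) = rotZ θ ((V x + b) - (V 0 + b)) :=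
    (map_sub (rotZL θ) (V x + b) (V 0 + b)).symm
  show V (rotZ θ x) - V 0 = rotZ θ (V x - V 0)
  rw [e1, hx, h0 θ, e2]
  congr 1
  abel

/-- The vorticity does not see a constant: `curl (V − c) = curl V`. [folklore] -/
theorem curl_sub_const_eq (V : EuclideanSpace ℝ (Fin 3) → EuclideanSpace ℝ (Fin 3))
    (c : EuclideanSpace ℝ (Fin 3)) : curl (fun y => V y - c) = curl V := by
  rw [curl_eq_curlCLM_comp, curl_eq_curlCLM_comp]
  have hF : fderiv ℝ (fun y => V y - c) = fderiv ℝ V := funext fun y => fderiv_sub_const c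
  rw [hF]

/-- The divergence does not see a constant: `V − c` is divergence free if `V` is. [folklore] -/
theorem isDivFree_sub_const {V : EuclideanSpace ℝ (Fin 3) → EuclideanSpace ℝ (Fin 3)}
    (hV : VectorCalculus.IsDivFree V) (c : EuclideanSpace ℝ (Fin 3)) :
    VectorCalculus.IsDivFree fun y => V y - c := fun x => by
  have h := hV x
  simp only [VectorCalculus.divergence] at h ⊢
  rwa [fderiv_sub_const]

end Pointwise

/-! ### Good times: the glued representative is axisymmetric up to its constant -/

section GoodTimes

/-- **Good times (axisymmetry only).** If `u : ℝ → ℝ³ → ℝ³` is axisymmetric as an `L^∞` function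
(for every angle `θ`, `u(t, R_θ x) = R_θ u(t, x)` for a.e. `x`, for a.e. `t < 0`) and
`u(t, ·) = U(t, ·) + b(t)` a.e. for a.e. `t < 0` with continuous slices `U(t, ·)`, then for a.e.
`t < 0` the continuous field `U(t, ·) + b(t)` is pointwise axisymmetric (rational angles and
density, `isAxisymmetric_of_ae_rat`; the variant of `ae_isAxisymmetric_hasNoSwirl_repr` without the
no-swirl hypothesis of Theorem 5.2). [cite: KochNadirashviliSereginSverak2009, proof of Thm 5.3, first lines (arXiv p. 10), with §4] -/
theorem ae_isAxisymmetric_repr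
    {u U : ℝ → EuclideanSpace ℝ (Fin 3) → EuclideanSpace ℝ (Fin 3)}
    {b : ℝ → EuclideanSpace ℝ (Fin 3)}
    (haxi : ∀ θ : ℝ, ∀ᵐ t ∂((volume : Measure ℝ).restrict (Iio 0)),
      (fun x => u t (rotZ θ x)) =ᵐ[volume] fun x => rotZ θ (u t x))
    (hae : ∀ᵐ t ∂((volume : Measure ℝ).restrict (Iio 0)), u t =ᵐ[volume] fun x => U t x + b t)
    (hcont : ∀ t < 0, Continuous (U t)) :
    ∀ᵐ t ∂((volume : Measure ℝ).restrict (Iio 0)), IsAxisymmetric (fun x => U t x + b t) := by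
  have hq : ∀ᵐ t ∂((volume : Measure ℝ).restrict (Iio 0)), ∀ q : ℚ,
      (fun x => u t (rotZ (q : ℝ) x)) =ᵐ[volume] fun x => rotZ (q : ℝ) (u t x) :=
    ae_all_iff.2 fun q => haxi q
  filter_upwards [hq, hae, ae_restrict_mem measurableSet_Iio] with t hqt hut ht
  have ht' : t < 0 := ht
  have hVc : Continuous fun x => U t x + b t := (hcont t ht').add continuous_const
  refine isAxisymmetric_of_ae_rat hVc fun q => ?_
  have h1 : (fun x => u t (rotZ (q : ℝ) x)) =ᵐ[volume] fun x => U t (rotZ (q : ℝ) x) + b t :=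
    (measurePreserving_rotZ (q : ℝ)).quasiMeasurePreserving.ae_eq hut
  have h2 : (fun x => rotZ (q : ℝ) (u t x)) =ᵐ[volume] fun x => rotZ (q : ℝ) (U t x + b t) := by
    filter_upwards [hut] with x hx
    rw [hx]
  exact h1.symm.trans ((hqt q).trans h2)

end GoodTimes

/-! ### The normalised glued field -/

section NormalisedGluing

variable {u : ℝ → EuclideanSpace ℝ (Fin 3) → EuclideanSpace ℝ (Fin 3)}
  {Uw : ℕ → ℝ → EuclideanSpace ℝ (Fin 3) → EuclideanSpace ℝ (Fin 3)}
  {bw : ℕ → ℝ → EuclideanSpace ℝ (Fin 3)} {ι : ℝ → ℕ}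

/-- **The normalisation is canonical.** On the common good range of two windows the normalised
fields `U_j(t, ·) − U_j(t, 0)` and `U_{j'}(t, ·) − U_{j'}(t, 0)` coincide, for *every* `t`
(`overlap_sub_eq`: the windowed fields differ by an `x`-independent constant — Remark 3.1 of the
source). [cite: KochNadirashviliSereginSverak2009, §3 Remark 3.1 (arXiv p. 7)] -/
theorem overlap_normalised_eq
    (hae : ∀ j : ℕ, ∀ᵐ t ∂((volume : Measure ℝ).restrict (Ioo (-(j : ℝ) - 4) (-(j : ℝ)))),
      u t =ᵐ[volume] fun x => Uw j t x + bw j t)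
    (hsm : ∀ j : ℕ, ∀ t ∈ Ioo (-(j : ℝ) - 4) (-(j : ℝ)), ContDiff ℝ ∞ (Uw j t))
    {L : ℕ → ℝ}
    (hlip : ∀ (j k : ℕ), ∀ s ∈ Ioo (-(j : ℝ) - 3) (-(j : ℝ)), ∀ t ∈ Ioo (-(j : ℝ) - 3) (-(j : ℝ)), ∀ x,
      ‖iteratedFDeriv ℝ k (Uw j t) x - iteratedFDeriv ℝ k (Uw j s) x‖ ≤ L k * |t - s|)
    {j j' : ℕ} {t : ℝ} (ht : t ∈ Ioo (-(j : ℝ) - 3) (-(j : ℝ)))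
    (ht' : t ∈ Ioo (-(j' : ℝ) - 3) (-(j' : ℝ))) (x : EuclideanSpace ℝ (Fin 3)) :
    Uw j t x - Uw j t 0 = Uw j' t x - Uw j' t 0 := by
  have h := overlap_sub_eq hae hsm hlip ht ht' x 0
  rwa [sub_eq_sub_iff_sub_eq_sub] at h

/-- **Order-`0` Lipschitz bound of the normalised glued field on all of `(−∞, 0)`**: nearby
times lie in a common good range, where the normalised field is canonical
(`overlap_normalised_eq`) and each windowed field is Lipschitz in time (constant `2 L 0` after
normalisation); distant times are covered by the uniform bound (`4 C 0`). [folklore] -/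
theorem norm_sub_normalised_glue_le
    (hae : ∀ j : ℕ, ∀ᵐ t ∂((volume : Measure ℝ).restrict (Ioo (-(j : ℝ) - 4) (-(j : ℝ)))),
      u t =ᵐ[volume] fun x => Uw j t x + bw j t)
    (hsm : ∀ j : ℕ, ∀ t ∈ Ioo (-(j : ℝ) - 4) (-(j : ℝ)), ContDiff ℝ ∞ (Uw j t))
    {C L : ℕ → ℝ}
    (hbd : ∀ (j k : ℕ), ∀ t ∈ Ioo (-(j : ℝ) - 3) (-(j : ℝ)), ∀ x, ‖iteratedFDeriv ℝ k (Uw j t) x‖ ≤ C k)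
    (hlip : ∀ (j k : ℕ), ∀ s ∈ Ioo (-(j : ℝ) - 3) (-(j : ℝ)), ∀ t ∈ Ioo (-(j : ℝ) - 3) (-(j : ℝ)), ∀ x,
      ‖iteratedFDeriv ℝ k (Uw j t) x - iteratedFDeriv ℝ k (Uw j s) x‖ ≤ L k * |t - s|)
    (hι : ∀ t < 0, -(ι t : ℝ) - 1 ≤ t ∧ t < -(ι t : ℝ)) :
    ∀ s < 0, ∀ t < 0, ∀ x,
      ‖(Uw (ι t) t x - Uw (ι t) t 0) - (Uw (ι s) s x - Uw (ι s) s 0)‖ ≤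
        max (2 * L 0) (4 * C 0) * |t - s| := by
  have hG : ∀ t < 0, t ∈ Ioo (-(ι t : ℝ) - 3) (-(ι t : ℝ)) := fun t ht =>
    ⟨by linarith [(hι t ht).1], (hι t ht).2⟩
  have hC : 0 ≤ C 0 := (norm_nonneg _).trans (hbd (ι (-1)) 0 (-1) (hG (-1) (by norm_num)) 0)
  have h0 : ∀ j : ℕ, ∀ τ ∈ Ioo (-(j : ℝ) - 3) (-(j : ℝ)), ∀ y, ‖Uw j τ y‖ ≤ C 0 := by
    intro j τ hτ y
    have := hbd j 0 τ hτ y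
    rwa [norm_iteratedFDeriv_zero] at this
  have hL0 : ∀ j : ℕ, ∀ s ∈ Ioo (-(j : ℝ) - 3) (-(j : ℝ)), ∀ t ∈ Ioo (-(j : ℝ) - 3) (-(j : ℝ)), ∀ y,
      ‖Uw j t y - Uw j s y‖ ≤ L 0 * |t - s| := by
    intro j s hs t ht y
    rw [norm_sub_eq_norm_iteratedFDeriv_zero_sub]
    exact hlip j 0 s hs t ht y
  have key : ∀ s t : ℝ, s ≤ t → s < 0 → t < 0 → ∀ x,
      ‖(Uw (ι t) t x - Uw (ι t) t 0) - (Uw (ι s) s x - Uw (ι s) s 0)‖ ≤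
        max (2 * L 0) (4 * C 0) * |t - s| := by
    intro s t hst hs ht x
    rcases lt_or_ge (t - s) 1 with hclose | hfar
    · -- both `s` and `t` lie in the good range of the window `ι t`
      have hsG : s ∈ Ioo (-(ι t : ℝ) - 3) (-(ι t : ℝ)) :=
        ⟨by linarith [(hι t ht).1], by linarith [(hι t ht).2]⟩
      rw [overlap_normalised_eq hae hsm hlip (hG s hs) hsG x]
      calc ‖(Uw (ι t) t x - Uw (ι t) t 0) - (Uw (ι t) s x - Uw (ι t) s 0)‖
          = ‖(Uw (ι t) t x - Uw (ι t) s x) - (Uw (ι t) t 0 - Uw (ι t) s 0)‖ := by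
            congr 1
            abel
        _ ≤ ‖Uw (ι t) t x - Uw (ι t) s x‖ + ‖Uw (ι t) t 0 - Uw (ι t) s 0‖ := norm_sub_le _ _
        _ ≤ L 0 * |t - s| + L 0 * |t - s| :=
            add_le_add (hL0 _ s hsG t (hG t ht) x) (hL0 _ s hsG t (hG t ht) 0)
        _ = 2 * L 0 * |t - s| := by ring
        _ ≤ max (2 * L 0) (4 * C 0) * |t - s| := by
            gcongr
            exact le_max_left _ _
    · have h1 : 1 ≤ |t - s| := by rw [abs_of_nonneg (by linarith)]; exact hfar
      calc ‖(Uw (ι t) t x - Uw (ι t) t 0) - (Uw (ι s) s x - Uw (ι s) s 0)‖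
          ≤ ‖Uw (ι t) t x - Uw (ι t) t 0‖ + ‖Uw (ι s) s x - Uw (ι s) s 0‖ := norm_sub_le _ _
        _ ≤ (‖Uw (ι t) t x‖ + ‖Uw (ι t) t 0‖) + (‖Uw (ι s) s x‖ + ‖Uw (ι s) s 0‖) :=
            add_le_add (norm_sub_le _ _) (norm_sub_le _ _)
        _ ≤ (C 0 + C 0) + (C 0 + C 0) :=
            add_le_add (add_le_add (h0 _ t (hG t ht) x) (h0 _ t (hG t ht) 0))
              (add_le_add (h0 _ s (hG s hs) x) (h0 _ s (hG s hs) 0))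
        _ = 4 * C 0 * 1 := by ring
        _ ≤ max (2 * L 0) (4 * C 0) * |t - s| :=
            mul_le_mul (le_max_right _ _) h1 zero_le_one
              (le_trans (by positivity) (le_max_right _ _))
  intro s hs t ht x
  rcases le_total s t with hst | hts
  · exact key s t hst hs ht x
  · rw [norm_sub_rev, abs_sub_comm]
    exact key t s hts ht hs x

/-- **All derivatives of the normalised glued field are Lipschitz in time on `(−∞, 0)`**,
uniformly in `x` (order `0`: `norm_sub_normalised_glue_le`; order `≥ 1`: the constant is not
seen, `glue_lipschitz`). [folklore] -/
theorem normalised_glue_lipschitz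
    (hae : ∀ j : ℕ, ∀ᵐ t ∂((volume : Measure ℝ).restrict (Ioo (-(j : ℝ) - 4) (-(j : ℝ)))),
      u t =ᵐ[volume] fun x => Uw j t x + bw j t)
    (hsm : ∀ j : ℕ, ∀ t ∈ Ioo (-(j : ℝ) - 4) (-(j : ℝ)), ContDiff ℝ ∞ (Uw j t))
    {C L : ℕ → ℝ}
    (hbd : ∀ (j k : ℕ), ∀ t ∈ Ioo (-(j : ℝ) - 3) (-(j : ℝ)), ∀ x, ‖iteratedFDeriv ℝ k (Uw j t) x‖ ≤ C k)
    (hlip : ∀ (j k : ℕ), ∀ s ∈ Ioo (-(j : ℝ) - 3) (-(j : ℝ)), ∀ t ∈ Ioo (-(j : ℝ) - 3) (-(j : ℝ)), ∀ x,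
      ‖iteratedFDeriv ℝ k (Uw j t) x - iteratedFDeriv ℝ k (Uw j s) x‖ ≤ L k * |t - s|)
    (hι : ∀ t < 0, -(ι t : ℝ) - 1 ≤ t ∧ t < -(ι t : ℝ)) (k : ℕ) :
    ∃ L' : ℝ, ∀ s < 0, ∀ t < 0, ∀ x,
      ‖iteratedFDeriv ℝ k (fun y => Uw (ι t) t y - Uw (ι t) t 0) x -
          iteratedFDeriv ℝ k (fun y => Uw (ι s) s y - Uw (ι s) s 0) x‖ ≤ L' * |t - s| := by
  cases k with
  | zero =>
    refine ⟨max (2 * L 0) (4 * C 0), fun s hs t ht x => ?_⟩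
    rw [← norm_sub_eq_norm_iteratedFDeriv_zero_sub]
    exact norm_sub_normalised_glue_le hae hsm hbd hlip hι s hs t ht x
  | succ n =>
    refine ⟨max (L (n + 1)) (2 * C (n + 1)), fun s hs t ht x => ?_⟩
    rw [iteratedFDeriv_succ_sub_const, iteratedFDeriv_succ_sub_const]
    exact glue_lipschitz hae hsm hbd hlip hι (Nat.succ_le_succ (Nat.zero_le n)) s hs t ht x

/-- **Uniform bounds for all derivatives of the normalised glued field on `(−∞, 0)`** (order
`0`: twice the window bound; order `≥ 1`: the window bound). [folklore] -/
theorem normalised_glue_bound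
    (hsm : ∀ j : ℕ, ∀ t ∈ Ioo (-(j : ℝ) - 4) (-(j : ℝ)), ContDiff ℝ ∞ (Uw j t))
    (hdf : ∀ j : ℕ, ∀ t ∈ Ioo (-(j : ℝ) - 4) (-(j : ℝ)), VectorCalculus.IsDivFree (Uw j t))
    {C : ℕ → ℝ}
    (hbd : ∀ (j k : ℕ), ∀ t ∈ Ioo (-(j : ℝ) - 3) (-(j : ℝ)), ∀ x, ‖iteratedFDeriv ℝ k (Uw j t) x‖ ≤ C k)
    (hι : ∀ t < 0, -(ι t : ℝ) - 1 ≤ t ∧ t < -(ι t : ℝ)) (k : ℕ) :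
    ∃ C' : ℝ, ∀ t < 0, ∀ x,
      ‖iteratedFDeriv ℝ k (fun y => Uw (ι t) t y - Uw (ι t) t 0) x‖ ≤ C' := by
  have hpt := (glue_pointwise hsm hdf hbd hι).2.2
  cases k with
  | zero =>
    refine ⟨C 0 + C 0, fun t ht x => ?_⟩
    rw [norm_iteratedFDeriv_zero]
    have h1 := hpt 0 t ht x
    have h2 := hpt 0 t ht 0
    rw [norm_iteratedFDeriv_zero] at h1 h2
    exact (norm_sub_le _ _).trans (add_le_add h1 h2)
  | succ n =>
    refine ⟨C (n + 1), fun t ht x => ?_⟩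
    rw [iteratedFDeriv_succ_sub_const]
    exact hpt (n + 1) t ht x

/-- **Axisymmetry of the normalised glued field at every time, and axiality of its constant at
a.e. time.** Under the `L^∞` axisymmetry hypothesis on `u`: for every `t < 0` the slice
`U_g(t, ·) − U_g(t, 0)` is axisymmetric, and for a.e. `t < 0` the constant
`b̂(t) = b_g(t) + U_g(t, 0)` is axial, `b̂(t) = b̂(t)₂ e_z` (good times by
`ae_isAxisymmetric_repr` and `isAxisymmetric_normalised`; every time by continuity in time of
the normalised field, `norm_sub_normalised_glue_le`, and `forall_eq_zero_of_ae_restrict_Iio`). [cite: KochNadirashviliSereginSverak2009, proof of Thm 5.3, first lines (arXiv p. 10), with §4 and Remark 3.1] -/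
theorem normalised_glue_isAxisymmetric
    (haxi : ∀ θ : ℝ, ∀ᵐ t ∂((volume : Measure ℝ).restrict (Iio 0)),
      (fun x => u t (rotZ θ x)) =ᵐ[volume] fun x => rotZ θ (u t x))
    (hae : ∀ j : ℕ, ∀ᵐ t ∂((volume : Measure ℝ).restrict (Ioo (-(j : ℝ) - 4) (-(j : ℝ)))),
      u t =ᵐ[volume] fun x => Uw j t x + bw j t)
    (hsm : ∀ j : ℕ, ∀ t ∈ Ioo (-(j : ℝ) - 4) (-(j : ℝ)), ContDiff ℝ ∞ (Uw j t))
    {C L : ℕ → ℝ}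
    (hbd : ∀ (j k : ℕ), ∀ t ∈ Ioo (-(j : ℝ) - 3) (-(j : ℝ)), ∀ x, ‖iteratedFDeriv ℝ k (Uw j t) x‖ ≤ C k)
    (hlip : ∀ (j k : ℕ), ∀ s ∈ Ioo (-(j : ℝ) - 3) (-(j : ℝ)), ∀ t ∈ Ioo (-(j : ℝ) - 3) (-(j : ℝ)), ∀ x,
      ‖iteratedFDeriv ℝ k (Uw j t) x - iteratedFDeriv ℝ k (Uw j s) x‖ ≤ L k * |t - s|)
    (hι : ∀ t < 0, -(ι t : ℝ) - 1 ≤ t ∧ t < -(ι t : ℝ)) :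
    (∀ t < 0, IsAxisymmetric fun y => Uw (ι t) t y - Uw (ι t) t 0) ∧
      ∀ᵐ t ∂((volume : Measure ℝ).restrict (Iio 0)),
        bw (ι t) t + Uw (ι t) t 0 = (bw (ι t) t + Uw (ι t) t 0) 2 • eZ := by
  have hW : ∀ t < 0, t ∈ Ioo (-(ι t : ℝ) - 4) (-(ι t : ℝ)) := fun t ht =>
    ⟨by linarith [(hι t ht).1], (hι t ht).2⟩
  have hcont : ∀ t < 0, Continuous fun y => Uw (ι t) t y := fun t ht =>
    (hsm _ t (hW t ht)).continuous
  -- good times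
  have hgood : ∀ᵐ t ∂((volume : Measure ℝ).restrict (Iio 0)),
      IsAxisymmetric fun y => Uw (ι t) t y + bw (ι t) t :=
    ae_isAxisymmetric_repr (U := fun t y => Uw (ι t) t y) (b := fun t => bw (ι t) t) haxi
      (ae_eq_glue hae hι) hcont
  refine ⟨?_, ?_⟩
  · -- every time, by continuity in time
    intro t ht θ x
    set φ : ℝ → EuclideanSpace ℝ (Fin 3) := fun τ =>
      (Uw (ι τ) τ (rotZ θ x) - Uw (ι τ) τ 0) - rotZ θ (Uw (ι τ) τ x - Uw (ι τ) τ 0) with hφ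
    have hV : ∀ y, ContinuousOn (fun τ => Uw (ι τ) τ y - Uw (ι τ) τ 0) (Iio 0) := fun y =>
      continuousOn_of_norm_sub_le_mul fun s hs τ hτ =>
        norm_sub_normalised_glue_le hae hsm hbd hlip hι s hs τ hτ y
    have hφc : ContinuousOn φ (Iio 0) :=
      (hV (rotZ θ x)).sub ((rotZL θ).continuous.comp_continuousOn (hV x))
    have hφ0 : ∀ᵐ τ ∂((volume : Measure ℝ).restrict (Iio 0)), φ τ = 0 := by
      filter_upwards [hgood] with τ hτ
      simp only [hφ]
      exact sub_eq_zero.2 ((isAxisymmetric_normalised hτ).1 θ x)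
    exact sub_eq_zero.1 (forall_eq_zero_of_ae_restrict_Iio hφc hφ0 t ht)
  · -- axiality of the constant at good times
    filter_upwards [hgood] with t ht
    exact eq_smul_eZ_of_rotZ_pi_eq ((isAxisymmetric_normalised ht).2 Real.pi)

/-- **The vorticity identity of the normalised glued field with axial drift.** The
time-integrated vorticity equation (4.5) of the glued field (drift `U_g + b_g`, `glue_vorticity`)
is that of the normalised field `V = U_g − U_g(·, 0)` with drift `V + β e_z`,
`β(τ) = b̂(τ)₂` for `τ < 0`: the vorticity and the Jacobian do not see the constant, and the
drifts `U_g + b_g = V + b̂` and `V + β e_z` agree for a.e. `τ`. [cite: KochNadirashviliSereginSverak2009, §4 (4.5) (arXiv p. 8) and proof of Thm 5.3, first lines (p. 10)] -/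
theorem normalised_glue_vorticity
    (hvortg : ∀ x, ∀ s t : ℝ, s ≤ t → t < 0 →
      curl (Uw (ι t) t) x - curl (Uw (ι s) s) x =
        ∫ τ in s..t, (Δ (curl (Uw (ι τ) τ)) x -
          fderiv ℝ (curl (Uw (ι τ) τ)) x (Uw (ι τ) τ x + bw (ι τ) τ) +
          fderiv ℝ (Uw (ι τ) τ) x (curl (Uw (ι τ) τ) x)))
    (haxial : ∀ᵐ t ∂((volume : Measure ℝ).restrict (Iio 0)),
      bw (ι t) t + Uw (ι t) t 0 = (bw (ι t) t + Uw (ι t) t 0) 2 • eZ)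
    {β : ℝ → ℝ} (hβ : ∀ t < 0, β t = (bw (ι t) t + Uw (ι t) t 0) 2) :
    ∀ x, ∀ s t : ℝ, s ≤ t → t < 0 →
      curl (fun y => Uw (ι t) t y - Uw (ι t) t 0) x - curl (fun y => Uw (ι s) s y - Uw (ι s) s 0) x =
        ∫ τ in s..t, ((Δ (curl fun y => Uw (ι τ) τ y - Uw (ι τ) τ 0)) x -
          fderiv ℝ (curl fun y => Uw (ι τ) τ y - Uw (ι τ) τ 0) x
            ((Uw (ι τ) τ x - Uw (ι τ) τ 0) + β τ • eZ) +
          fderiv ℝ (fun y => Uw (ι τ) τ y - Uw (ι τ) τ 0) x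
            (curl (fun y => Uw (ι τ) τ y - Uw (ι τ) τ 0) x)) := by
  intro x s t hst ht
  have hcurl : ∀ τ, curl (fun y => Uw (ι τ) τ y - Uw (ι τ) τ 0) = curl (Uw (ι τ) τ) := fun τ =>
    curl_sub_const_eq _ _
  have hF : ∀ τ, fderiv ℝ (fun y => Uw (ι τ) τ y - Uw (ι τ) τ 0) = fderiv ℝ (Uw (ι τ) τ) :=
    fun τ => funext fun y => fderiv_sub_const _
  simp only [hcurl, hF]
  rw [hvortg x s t hst ht]
  have hax' : ∀ᵐ τ ∂(volume : Measure ℝ), τ ∈ Iio (0 : ℝ) →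
      bw (ι τ) τ + Uw (ι τ) τ 0 = (bw (ι τ) τ + Uw (ι τ) τ 0) 2 • eZ :=
    (ae_restrict_iff' measurableSet_Iio).1 haxial
  refine intervalIntegral.integral_congr_ae ?_
  filter_upwards [hax'] with τ hτ hτI
  rw [uIoc_of_le hst] at hτI
  have hτ0 : τ < 0 := lt_of_le_of_lt hτI.2 ht
  have hdrift : Uw (ι τ) τ x + bw (ι τ) τ = (Uw (ι τ) τ x - Uw (ι τ) τ 0) + β τ • eZ := by
    rw [hβ τ hτ0, ← hτ hτ0]
    abel
  rw [hdrift]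

end NormalisedGluing

/-! ### Assembly -/

section Assembly

/-- **KNSS 2009, §4 with (5.10) for the axisymmetric representative, from §4 on finite
windows.** The named fact `KNSS2009_regularity_axisymmetric_swirl` (the form of §4 consumed by
the proof of Theorem 5.3: an axisymmetric smooth representative `U` with axial parasitic part
`β(t) e_z`, uniform bounds (4.7), time-Lipschitz bounds (4.8) for all `k ≥ 0`, and the swirl
equation (5.10) in time-integrated form) follows from the printed finite-window statement
`KNSS2009_regularity_boundedWeak_window`: glue the windowed decompositions as in
`KNSS2009_regularity_boundedWeak_ancient_of_window`, normalise the glued field at the axis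
(`V = U_g − U_g(·, 0)`, canonical by Remark 3.1, hence Lipschitz in time at order `0` too;
axisymmetric at every `t < 0`, with axial constant `b̂ = β e_z` at a.e. `t`, because `u` is
axisymmetric in `L^∞`), transfer the vorticity equation (4.5), and derive (5.10) from it
(`swirl_identity_of_vorticity_identity`). [cite: KochNadirashviliSereginSverak2009, §4 (4.5)–(4.8) (arXiv p. 8) and proof of Thm 5.3, (5.10) (p. 10)] -/
theorem KNSS2009_regularity_axisymmetric_swirl_of_window
    (h : KNSS2009_regularity_boundedWeak_window) : KNSS2009_regularity_axisymmetric_swirl := by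
  intro u hu haxi
  obtain ⟨M, hM⟩ := hu.isBoundedOn
  obtain ⟨C, L, N, hwin⟩ := KNSS2009_regularity_boundedWeak_window.shift h M 4 (by norm_num)
  have hneg : ∀ (j : ℕ) (t : ℝ), t ∈ Ioo (-(j : ℝ) - 4) (-(j : ℝ)) → t < 0 := fun j t ht =>
    lt_of_lt_of_le ht.2 (neg_nonpos.2 (Nat.cast_nonneg j))
  have hsol : ∀ j : ℕ, IsBoundedWeakNSSolutionOn (Ioo (-(j : ℝ) - 4) (-(j : ℝ))) isOpen_Ioo 1 u :=
    fun j => hu.mono isOpen_Ioo fun t ht => hneg j t ht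
  have hbdd : ∀ j : ℕ, ∀ t ∈ Ioo (-(j : ℝ) - 4) (-(j : ℝ)), ∀ x, ‖u t x‖ ≤ M :=
    fun j t ht x => hM t (hneg j t ht) x
  choose Uw bw hspec using fun j : ℕ =>
    hwin (-(j : ℝ) - 4) (-(j : ℝ)) (by ring) (hsol j) (hbdd j)
  -- the window data in the shape of the gluing lemmas (`δ = 1`)
  set C1 : ℕ → ℝ := fun k => C k 1 with hC1
  set L1 : ℕ → ℝ := fun k => L k 1 with hL1
  have hbm : ∀ j, Measurable (bw j) := fun j => (hspec j).1
  have hbN : ∀ j t, ‖bw j t‖ ≤ N := fun j => (hspec j).2.1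
  have hUm : ∀ j, Measurable (uncurry (Uw j)) := fun j => (hspec j).2.2.1
  have hae : ∀ j : ℕ, ∀ᵐ t ∂((volume : Measure ℝ).restrict (Ioo (-(j : ℝ) - 4) (-(j : ℝ)))),
      u t =ᵐ[volume] fun x => Uw j t x + bw j t := fun j => (hspec j).2.2.2.1
  have hsm : ∀ j : ℕ, ∀ t ∈ Ioo (-(j : ℝ) - 4) (-(j : ℝ)), ContDiff ℝ ∞ (Uw j t) :=
    fun j => (hspec j).2.2.2.2.1
  have hdf : ∀ j : ℕ, ∀ t ∈ Ioo (-(j : ℝ) - 4) (-(j : ℝ)), VectorCalculus.IsDivFree (Uw j t) :=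
    fun j => (hspec j).2.2.2.2.2.1
  have hbd : ∀ (j k : ℕ), ∀ t ∈ Ioo (-(j : ℝ) - 3) (-(j : ℝ)), ∀ x,
      ‖iteratedFDeriv ℝ k (Uw j t) x‖ ≤ C1 k := fun j k t ht x =>
    (hspec j).2.2.2.2.2.2.1 1 one_pos k t ⟨by linarith [ht.1], ht.2⟩ x
  have hlip : ∀ (j k : ℕ), ∀ s ∈ Ioo (-(j : ℝ) - 3) (-(j : ℝ)), ∀ t ∈ Ioo (-(j : ℝ) - 3) (-(j : ℝ)),
      ∀ x, ‖iteratedFDeriv ℝ k (Uw j t) x - iteratedFDeriv ℝ k (Uw j s) x‖ ≤ L1 k * |t - s| :=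
    fun j k s hs t ht x => (hspec j).2.2.2.2.2.2.2.1 1 one_pos k s ⟨by linarith [hs.1], hs.2⟩ t
      ⟨by linarith [ht.1], ht.2⟩ x
  have hvort : ∀ (j : ℕ) (x : EuclideanSpace ℝ (Fin 3)) (s t : ℝ),
      -(j : ℝ) - 3 < s → s ≤ t → t < -(j : ℝ) →
      curl (Uw j t) x - curl (Uw j s) x =
        ∫ τ in s..t, (Δ (curl (Uw j τ)) x - fderiv ℝ (curl (Uw j τ)) x (Uw j τ x + bw j τ) +
          fderiv ℝ (Uw j τ) x (curl (Uw j τ) x)) :=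
    fun j x s t hs hst ht => (hspec j).2.2.2.2.2.2.2.2 x s t (by linarith) hst ht
  -- the selection of pieces `t ∈ [−ι t − 1, −ι t)`
  set ι : ℝ → ℕ := fun t => ⌈-t⌉₊ - 1 with hιdef
  have hι : ∀ t < 0, -(ι t : ℝ) - 1 ≤ t ∧ t < -(ι t : ℝ) := by
    intro t ht
    have hpos : 0 < -t := by linarith
    have h1 : 1 ≤ ⌈-t⌉₊ := Nat.ceil_pos.2 hpos
    have hcast : (ι t : ℝ) = (⌈-t⌉₊ : ℝ) - 1 := by
      simp only [hιdef]
      rw [Nat.cast_sub h1, Nat.cast_one]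
    rw [hcast]
    have h2 : (-t) ≤ ⌈-t⌉₊ := Nat.le_ceil _
    have h3 : (⌈-t⌉₊ : ℝ) < -t + 1 := Nat.ceil_lt_add_one hpos.le
    constructor <;> linarith
  have hιm : Measurable ι :=
    (measurable_from_nat (f := fun n : ℕ => n - 1)).comp (Nat.measurable_ceil.comp measurable_neg)
  have hW : ∀ t < 0, t ∈ Ioo (-(ι t : ℝ) - 4) (-(ι t : ℝ)) := fun t ht =>
    ⟨by linarith [(hι t ht).1], (hι t ht).2⟩
  have hpt := glue_pointwise (ι := ι) hsm hdf hbd hι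
  have hvortg := glue_vorticity hbm hbN hae hsm hbd hlip hvort hι
  obtain ⟨haxV, haxial⟩ := normalised_glue_isAxisymmetric haxi hae hsm hbd hlip hι
  -- the normalised representative and its axial constant
  set β : ℝ → ℝ := fun t => if t < 0 then (bw (ι t) t + Uw (ι t) t 0) 2 else 0 with hβdef
  have hβ : ∀ t < 0, β t = (bw (ι t) t + Uw (ι t) t 0) 2 := fun t ht => by
    simp only [hβdef, if_pos ht]
  have hU0m : Measurable fun t : ℝ => Uw (ι t) t 0 :=
    (measurable_uncurry_glue hUm hιm).comp (measurable_id.prodMk measurable_const)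
  have hbhm : Measurable fun t : ℝ => bw (ι t) t + Uw (ι t) t 0 :=
    (measurable_glue hbm hιm).add hU0m
  have hβm : Measurable β := by
    refine Measurable.ite measurableSet_Iio ?_ measurable_const
    exact (contDiff_piLp_apply (𝕜 := ℝ) (p := 2) (n := 0)
      (i := (2 : Fin 3))).continuous.measurable.comp hbhm
  have hC0 : ∀ t < 0, ‖Uw (ι t) t 0‖ ≤ C1 0 := fun t ht => by
    have := hpt.2.2 0 t ht 0
    rwa [norm_iteratedFDeriv_zero] at this
  have hβb : ∀ t, |β t| ≤ N + C1 0 := by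
    have hNC : 0 ≤ N + C1 0 :=
      add_nonneg ((norm_nonneg _).trans (hbN 0 0)) ((norm_nonneg _).trans (hC0 (-1) (by norm_num)))
    intro t
    by_cases ht : t < 0
    · rw [hβ t ht, ← Real.norm_eq_abs]
      calc ‖(bw (ι t) t + Uw (ι t) t 0) 2‖ ≤ ‖bw (ι t) t + Uw (ι t) t 0‖ := PiLp.norm_apply_le _ 2
        _ ≤ ‖bw (ι t) t‖ + ‖Uw (ι t) t 0‖ := norm_add_le _ _
        _ ≤ N + C1 0 := add_le_add (hbN _ _) (hC0 t ht)
    · simp only [hβdef, if_neg ht, abs_zero]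
      exact hNC
  -- the global time-Lipschitz bounds, all orders
  have hlipV := normalised_glue_lipschitz hae hsm hbd hlip hι
  choose L' hL' using hlipV
  refine ⟨fun t y => Uw (ι t) t y - Uw (ι t) t 0, β, hβm, ⟨N + C1 0, hβb⟩, ?_, ?_,
    fun t ht => (hpt.1 t ht).sub contDiff_const,
    fun t ht => isDivFree_sub_const (hpt.2.1 t ht) _, haxV,
    normalised_glue_bound hsm hdf hbd hι, fun k => ⟨L' k, hL' k⟩, ?_⟩
  · -- joint measurability
    have hG := measurable_uncurry_glue hUm hιm
    exact hG.sub (hG.comp (measurable_fst.prodMk measurable_const))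
  · -- the a.e. identity `u = V + β e_z`
    filter_upwards [ae_eq_glue hae hι, haxial, ae_restrict_mem measurableSet_Iio] with t hut hax ht
    have ht' : t < 0 := ht
    filter_upwards [hut] with x hx
    rw [hx]
    show Uw (ι t) t x + bw (ι t) t = (Uw (ι t) t x - Uw (ι t) t 0) + β t • eZ
    rw [hβ t ht', ← hax]
    abel
  · -- the swirl equation (5.10), from the vorticity equation (4.5)
    exact swirl_identity_of_vorticity_identity (fun t ht => (hpt.1 t ht).sub contDiff_const)
      (fun t ht => isDivFree_sub_const (hpt.2.1 t ht) _) haxV (fun k => ⟨L' k, hL' k⟩) hβm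
      ⟨N + C1 0, hβb⟩ (normalised_glue_vorticity hvortg haxial hβ)

/-- **KNSS 2009, Theorem 5.3, from §4 on finite windows alone**: the printed theorem follows
from the single named fact `KNSS2009_regularity_boundedWeak_window` (§4 (4.8)–(4.11) with
Lemma 3.1 on `ℝ³ × (0, T)`), everything else — Lemma 2.1, the cut-off argument (5.12)–(5.20),
Theorem 5.2, the axisymmetric representative and (5.10) — being proved. [cite: KochNadirashviliSereginSverak2009, Thm 5.3 and its proof (arXiv p. 10)] -/
theorem KNSS2009_liouville_bound_C_over_r_of_window (hwin : KNSS2009_regularity_boundedWeak_window) :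
    KNSS2009_liouville_bound_C_over_r :=
  KNSS2009_liouville_bound_C_over_r_of_regularity_of_window
    (KNSS2009_regularity_axisymmetric_swirl_of_window hwin) hwin

/-- **KNSS 2009, Theorem 5.3, from Proposition 4.1 for restarted mild solutions**
(`KNSS2009_prop41_mild`, through `KNSS2009_regularity_boundedWeak_window_of_prop41_mild`). [cite: KochNadirashviliSereginSverak2009, Thm 5.3 (arXiv p. 10) with Prop. 4.1 (p. 8)] -/
theorem KNSS2009_liouville_bound_C_over_r_of_prop41_mild (h41 : KNSS2009_prop41_mild) :
    KNSS2009_liouville_bound_C_over_r :=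
  KNSS2009_liouville_bound_C_over_r_of_window (KNSS2009_regularity_boundedWeak_window_of_prop41_mild h41)

/-- **KNSS 2009, Theorem 5.3, from the local smoothing statement (L) alone**
(`knss2009_local_smoothing ℝ³`, Proposition 4.1 in its quantitative short-time form, through
`KNSS2009_prop41_mild_of_local`): the one remaining unproved input of the printed theorem in the
tree. [cite: KochNadirashviliSereginSverak2009, Thm 5.3 (arXiv p. 10) with Prop. 4.1 (p. 8)] -/
theorem KNSS2009_liouville_bound_C_over_r_of_local
    (hL : knss2009_local_smoothing (EuclideanSpace ℝ (Fin 3))) : KNSS2009_liouville_bound_C_over_r :=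
  KNSS2009_liouville_bound_C_over_r_of_prop41_mild (KNSS2009_prop41_mild_of_local hL)

/-- **The tree's duality-form Theorem 5.3 (`knss_bound_C_over_r`) from §4 on finite windows
alone**, through the printed theorem and the proved bridge `knss_bound_C_over_r_of_KNSS2009`. [cite: KochNadirashviliSereginSverak2009, Thm 5.3 and its proof (arXiv p. 10)] -/
theorem knss_bound_C_over_r_of_window (hwin : KNSS2009_regularity_boundedWeak_window) :
    knss_bound_C_over_r :=
  knss_bound_C_over_r_of_KNSS2009 (KNSS2009_liouville_bound_C_over_r_of_window hwin)

/-- **The tree's duality-form Theorem 5.3 from the local smoothing statement (L) alone.** [cite: KochNadirashviliSereginSverak2009, Thm 5.3 (arXiv p. 10) with Prop. 4.1 (p. 8)] -/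
theorem knss_bound_C_over_r_of_local (hL : knss2009_local_smoothing (EuclideanSpace ℝ (Fin 3))) :
    knss_bound_C_over_r :=
  knss_bound_C_over_r_of_KNSS2009 (KNSS2009_liouville_bound_C_over_r_of_local hL)

end Assembly

/-! ### Discharges: Theorems 5.2 and 5.3 proved -/

section Discharge

/-- **KNSS 2009, §4 on finite windows (`KNSS2009_regularity_boundedWeak_window`), PROVED**: from
the §4 regularity of bounded mild solutions (`KNSS2009_mild_regularity_holds`) through Lemma 3.1
and Galilean covariance (`KNSS2009_regularity_boundedWeak_window_of_mild_regularity`). [cite: KochNadirashviliSereginSverak2009, §4 (4.8)–(4.11) with Lemma 3.1 (3.17)–(3.18) (arXiv:0709.3599v1 p. 8)] -/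
theorem KNSS2009_regularity_boundedWeak_window_holds : KNSS2009_regularity_boundedWeak_window :=
  KNSS2009_regularity_boundedWeak_window_of_mild_regularity KNSS2009_mild_regularity_holds

/-- **KNSS 2009, §4 with (5.10) for the axisymmetric representative
(`KNSS2009_regularity_axisymmetric_swirl`), PROVED** (`KNSS2009_regularity_axisymmetric_swirl_of_window`). [cite: KochNadirashviliSereginSverak2009, §4 (4.6)–(4.8) p. 8 and proof of Thm 5.3, (5.10) (arXiv p. 10)] -/
theorem KNSS2009_regularity_axisymmetric_swirl_holds : KNSS2009_regularity_axisymmetric_swirl :=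
  KNSS2009_regularity_axisymmetric_swirl_of_window KNSS2009_regularity_boundedWeak_window_holds

/-- **KNSS 2009, Theorem 5.2 (Liouville theorem for axisymmetric bounded ancient weak solutions
without swirl), PROVED** (`KNSS2009_liouville_axisymmetric_no_swirl_of_window`). [cite: KochNadirashviliSereginSverak2009, Thm 5.2 (arXiv pp. 9–10)] -/
theorem KNSS2009_liouville_axisymmetric_no_swirl_holds : KNSS2009_liouville_axisymmetric_no_swirl :=
  KNSS2009_liouville_axisymmetric_no_swirl_of_window KNSS2009_regularity_boundedWeak_window_holds

/-- **The duality-form Theorem 5.2 (`knss2009_axisymmetric_no_swirl`), PROVED**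
(`knss2009_axisymmetric_no_swirl_of_window`). [cite: KochNadirashviliSereginSverak2009, Thm 5.2 (arXiv pp. 9–10)] -/
theorem knss2009_axisymmetric_no_swirl_holds : knss2009_axisymmetric_no_swirl :=
  knss2009_axisymmetric_no_swirl_of_window KNSS2009_regularity_boundedWeak_window_holds

/-- **The `ℝ³`-valued corollary of Theorem 5.2 (`knss2009_axisymmetric_no_swirl'`), PROVED**
(`knss2009_axisymmetric_no_swirl'_of_window`). [cite: KochNadirashviliSereginSverak2009, Thm 5.2 (arXiv pp. 9–10)] -/
theorem knss2009_axisymmetric_no_swirl'_holds : knss2009_axisymmetric_no_swirl' :=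
  knss2009_axisymmetric_no_swirl'_of_window KNSS2009_regularity_boundedWeak_window_holds

/-- **KNSS 2009, Theorem 5.3 (Liouville theorem for axisymmetric bounded ancient weak solutions
with `|u| ≤ C/r`), PROVED**: "Let `u` be a bounded weak solution of the Navier–Stokes equations
in `ℝ³ × (−∞, 0)`. Assume that `u` is axi-symmetric and, in addition, satisfies
`|u(x,t)| ≤ C/√(x₁² + x₂²)` in `ℝ³ × (−∞, 0)`. Then `u = 0` in `ℝ³ × (−∞, 0)`." All steps of
the printed proof are theorems of the tree: §4 on finite windows
(`KNSS2009_regularity_boundedWeak_window_holds`), the axisymmetric representative with (5.10)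
(`KNSS2009_regularity_axisymmetric_swirl_of_window`), Lemma 2.1 (`KNSS2009_lemma21_holds`), the
scaling and cut-off argument (5.12)–(5.20) (`KNSS2009_swirl_sup_nonpos_holds`) and Theorem 5.2
(`KNSS2009_liouville_axisymmetric_no_swirl_of_window`), composed in
`KNSS2009_liouville_bound_C_over_r_of_window`. [cite: KochNadirashviliSereginSverak2009, Thm 5.3 and its proof (arXiv p. 10)] -/
theorem KNSS2009_liouville_bound_C_over_r_holds : KNSS2009_liouville_bound_C_over_r :=
  KNSS2009_liouville_bound_C_over_r_of_window KNSS2009_regularity_boundedWeak_window_holds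

/-- **The duality-form Theorem 5.3 (`knss_bound_C_over_r`, ns.S22), PROVED**
(`knss_bound_C_over_r_of_window`, through the bridge `knss_bound_C_over_r_of_KNSS2009`). [cite: KochNadirashviliSereginSverak2009, Thm 5.3 and its proof (arXiv p. 10)] -/
theorem knss_bound_C_over_r_holds : knss_bound_C_over_r :=
  knss_bound_C_over_r_of_window KNSS2009_regularity_boundedWeak_window_holds

end Discharge

end Literature.Analysis.FluidPDE

end
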